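import Literature.Barriers.CriticalPhenomena.AmenableInvariantPercolationMarkov
import Literature.Barriers.CriticalPhenomena.AmenableInvariantPercolationProfile

/-!
# Barrier audit gen-15: BOUNDED clusters — the tiling witnesses, and the one threshold they obey

Barrier catalogue `Literature/Barriers/CriticalPhenomena/` (D-0021); audit artifact (2026-08-16,
gen-15) of `AmenableInvariantPercolationProofs.lean` / the entry `AmenableInvariantPercolation`
(Lyons–Peres 2016, Thm. 8.37, "amenable ⟹": on a connected, locally finite, transitive, amenable
graph there are automorphism-invariant site percolations with only finite clusters and density
`> α`, for every `α < 1`).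

## The witnesses in tiling form (in print)

The printed proof (Lyons–Peres 2016, pp. 412–413) and the tree's `config` / `perc`
(`AmenableInvariantPercolationProofs.lean`) remove the boundaries of randomly activated copies of
LARGER AND LARGER Følner sets, so their finite clusters are unbounded in size at every density
level. Three neighbouring literatures deliver the same witnesses as random TILINGS by finitely
many bounded Følner tiles, i.e. with clusters of UNIFORMLY BOUNDED size at each density level:

* exact tilings of every countable amenable group by finitely many `(K, ε)`-invariant shapes, of
  topological entropy zero and nested ("congruent") along `ε_k → 0`
  [cite: DownarowiczHuczekZhang2016, Thm. 4.3 and Thm. 5.2] (an invariant random tiling follows by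
  averaging over the amenable group, on paper: Følner averages of the translates of one such
  tiling have weak-* limit points in the compact space of tilings by the given shapes, and these
  are invariant laws under which every vertex lies on the boundary of its tile with probability
  `≤ ε`, the boundary of the tiling having upper Banach density `≤ ε`);
* measurable tilings with `(K, δ)`-invariant shapes of every FREE probability-measure-preserving
  action of a countable amenable group [cite: ConleyEtAl2018, Thm. 3.6]: applied to a Bernoulli
  shift they are factor-of-i.i.d. tilings; applied to the free p.m.p. action of `ℤ^d` on the
  critical configuration `(2^{E(ℤ^d)}, P_{p_c})` itself they give bounded-cluster sub-percolations
  of `ω_{p_c}` — and of the hypothetical critical infinite cluster — of relative density `→ 1`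
  that are equivariant functions of `ω_{p_c}` ALONE, with no auxiliary randomness (unlike the BLPS
  percolation `ξ_ε`, whose selector `W` uses extra coins
  [cite: LyonsPeres2016, Thm. 8.21 (proof, p. 403)]); `Aut(ℤ^d)`-equivariance by intersecting the
  images under the finite point group (on paper): so "intrinsic to the critical configuration"
  is no lever for a size-blind threshold either;
* STRONG ALMOST FINITENESS [cite: ElekTimar2023, §1.2 (9), Thm. 3 and Thm. 4]: a bounded-degree
  graph with Property A and the uniform Følner property carries, for every `ε > 0`, a random
  tiling by `ε`-Følner sets of bounded diameter under which every vertex lies on the boundary of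
  its tile with probability `< ε` — in particular every bounded-degree graph of subexponential
  growth and every Schreier graph of a finitely generated amenable group
  [cite: ElekTimar2023, Prop. 7.3 and Prop. 7.4] (the Cayley case being
  [cite: DownarowiczHuczekZhang2016, Thm. 4.3]).

## What bounded clusters buy (PROVED here, on `ℤ^d`)

Exactly the size-SENSITIVE threshold of audit gen-2 (`AmenableInvariantPercolationProfile.lean`),
and nothing size-blind:

* `measureReal_mem_le_of_boundedClusters_zd`, `AmenableInvariantPercolation_bounded_evasion_zd`:
  for `d ≥ 1` and each `M`, every automorphism-invariant site percolation on `ℤ^d` whose cluster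
  of the origin has almost surely at most `M` vertices has density `≤ 2dM / (2dM + 1) < 1` at the
  origin — the profile bound `E[ |∂_V^in K(0)| / |K(0)| ] ≤ 2d · P[0 ∉ ω]`
  (`lintegral_bdryRatio_le_zd`, [cite: LyonsPeres2016, Cor. 8.38 (proof, p. 414)]) with
  `|∂_V^in K(0)| ≥ 1` (a finite cluster of the infinite connected `ℤ^d` has a vertex with a closed
  neighbour) and `|K(0)| ≤ M`; the isoperimetric rate `1 - c_d M^{-1/d}`
  [cite: LyonsPeres2016, Thm. 6.22] is cited, not formalised; the exception `d = 0` is genuine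
  (one open vertex: bounded clusters, density `1`);
* `AmenableInvariantPercolation_bounded_zd`, `AmenableInvariantPercolation_bounded_threshold_zd`:
  no `α < 1` serves for all `M` at once — the random-phase grid of period `L` of audit gen-12
  (`gridPerc`, `AmenableInvariantPercolationMarkov.lean`; the `ℤ^d` device of the printed proof
  [cite: LyonsPeres2016, Thm. 8.37 (proof, p. 412)]) keeps every cluster inside a box of
  `(L + 1)^d` sites (`gridConfig_exists_box`) at density `≥ 1 - d/L`.

So hypotheses on the SHAPE of the finite clusters — uniformly bounded, finitely many isomorphism
types, convex boxes, a single tile type (on `ℤ^d`), complements connected — select the tiling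
witnesses among the Thm. 8.37 witnesses without restoring any size-blind threshold; only the SIZE
enters, through the profile bound.

## References

* R. Lyons, Y. Peres, *Probability on Trees and Networks*, CUP 2016, Thm. 8.37 (proof p. 412),
  Cor. 8.38 (proof p. 414), Thm. 6.22, Thm. 8.21 (proof p. 403). [LyonsPeres2016]
* T. Downarowicz, D. Huczek, G. Zhang, *Tilings of amenable groups*, J. reine angew. Math. 747
  (2019) 277–298 (arXiv:1502.02413), Thm. 4.3, Thm. 5.2. [DownarowiczHuczekZhang2016]
* C. T. Conley, S. Jackson, D. Kerr, A. S. Marks, B. Seward, R. D. Tucker-Drob, *Følner tilings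
  for actions of amenable groups*, Math. Ann. 371 (2018) 663–683 (arXiv:1704.00699), Thm. 3.6.
  [ConleyEtAl2018]
* G. Elek, Á. Timár, *Strong almost finiteness*, J. Funct. Anal. 289 (2025), arXiv:2308.14554,
  §1.2, Thms. 1–4, Props. 7.3–7.4. [ElekTimar2023]
-/

noncomputable section

namespace Literature.Barriers.CriticalPhenomena

open MeasureTheory Finset Filter
open scoped ENNReal
open Literature.Probability.LatticeModels Literature.Probability.Percolation
open Literature.MathematicalPhysics.QuantumFieldTheory.LatticeForm (add_single_apply_self
  add_single_apply_of_ne)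

/-! ### §1. The bounded-cluster event -/

section Bounded

variable {V : Type*} {G : SimpleGraph V}

variable (G) in
/-- The event "every open cluster is finite with at most `M` vertices". [folklore] -/
def boundedClusters (M : ℕ) : Set (SiteConfig V) :=
  {ω | ∀ x : V, (siteCluster G ω x).Finite ∧ (siteCluster G ω x).ncard ≤ M}

/-- Unfolding lemma for `boundedClusters`. [folklore] -/
theorem mem_boundedClusters {M : ℕ} {ω : SiteConfig V} :
    ω ∈ boundedClusters G M ↔
      ∀ x : V, (siteCluster G ω x).Finite ∧ (siteCluster G ω x).ncard ≤ M :=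
  Iff.rfl

omit G in
/-- A set is finite with at most `M` elements iff it lies in a finset of at most `M` elements.
[folklore] -/
theorem finite_and_ncard_le_iff {M : ℕ} {s : Set V} :
    (s.Finite ∧ s.ncard ≤ M) ↔ ∃ C : Finset V, C.card ≤ M ∧ s ⊆ ↑C := by
  constructor
  · rintro ⟨hfin, hcard⟩
    refine ⟨hfin.toFinset, ?_, fun y hy => hfin.mem_toFinset.2 hy⟩
    rwa [← Set.ncard_eq_toFinset_card s hfin]
  · rintro ⟨C, hC, hsub⟩
    refine ⟨C.finite_toSet.subset hsub, ?_⟩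
    calc s.ncard ≤ (↑C : Set V).ncard := Set.ncard_le_ncard hsub C.finite_toSet
      _ = C.card := Set.ncard_coe_finset C
      _ ≤ M := hC

variable [DecidableEq V] [G.LocallyFinite]

/-- `boundedClusters` is measurable (`V` countable): countably many cluster-membership events.
[folklore] -/
theorem measurableSet_boundedClusters [Countable V] (M : ℕ) :
    MeasurableSet (boundedClusters G M) := by
  have key : boundedClusters G M =
      ⋂ x : V, ⋃ C : Finset V, {_ω : SiteConfig V | C.card ≤ M} ∩
        ⋂ y : V, ({ω : SiteConfig V | y ∈ siteCluster G ω x}ᶜ ∪ {_ω : SiteConfig V | y ∈ C}) := by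
    ext ω
    simp only [boundedClusters, Set.mem_setOf_eq, Set.mem_iInter, Set.mem_iUnion,
      Set.mem_inter_iff, Set.mem_union, Set.mem_compl_iff]
    refine forall_congr' fun x => ?_
    rw [finite_and_ncard_le_iff]
    refine exists_congr fun C => and_congr_right fun _ => forall_congr' fun y => ?_
    exact imp_iff_not_or
  rw [key]
  refine MeasurableSet.iInter fun x => MeasurableSet.iUnion fun C =>
    (MeasurableSet.const _).inter (MeasurableSet.iInter fun y => ?_)
  exact (measurableSet_mem_siteCluster x y).compl.union (MeasurableSet.const _)

end Bounded

/-! ### §2. The size-sensitive threshold for bounded clusters on `ℤ^d` -/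

section Threshold

variable {d : ℕ}

/-- On `ℤ^d`, `d ≥ 1`: if the origin is open and its cluster is finite with at most `M`
vertices, then `|∂_V^in K(0)| / |K(0)| ≥ 1/M` (some cluster vertex has a closed neighbour,
`ℤ^d` being infinite and connected). [folklore] -/
theorem inv_le_bdryRatio_of_ncard_le (hd : 0 < d) {ω : SiteConfig (Site d)} {M : ℕ}
    (h0 : (0 : Site d) ∈ ω) (hfin : (siteCluster (zdGraph d) ω 0).Finite)
    (hM : (siteCluster (zdGraph d) ω 0).ncard ≤ M) :
    (M : ℝ≥0∞)⁻¹ ≤ bdryRatio (zdGraph d) ω 0 := by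
  classical
  haveI : Infinite (Site d) :=
    Infinite.of_injective (fun n : ℤ => fun _ : Fin d => n) fun a b h => by
      have := congrFun h ⟨0, hd⟩
      simpa using this
  -- a vertex outside the finite cluster, and a boundary dart on a walk to it
  obtain ⟨z, hz⟩ := Infinite.exists_notMem_finset hfin.toFinset
  rw [Set.Finite.mem_toFinset] at hz
  have h0K : (0 : Site d) ∈ siteCluster (zdGraph d) ω 0 := (mem_siteCluster_self_iff _ _ _).2 h0
  obtain ⟨p⟩ := (zdGraph_connected d).preconnected (0 : Site d) z
  obtain ⟨e, -, he1, he2⟩ := p.exists_boundary_dart (siteCluster (zdGraph d) ω 0) h0K hz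
  have hwω : e.toProd.2 ∉ ω := (notMem_siteCluster_iff_of_adj he1 e.adj).1 he2
  have hvB : e.toProd.1 ∈ clusterInnerBdry (zdGraph d) ω 0 := ⟨he1, e.toProd.2, e.adj, hwω⟩
  have hB : (1 : ℝ≥0∞) ≤ ((clusterInnerBdry (zdGraph d) ω 0).encard : ℝ≥0∞) := by
    have h1 : (1 : ℕ∞) ≤ (clusterInnerBdry (zdGraph d) ω 0).encard :=
      Set.one_le_encard_iff_nonempty.2 ⟨_, hvB⟩
    have h2 := ENat.toENNReal_le.2 h1
    simpa using h2
  have hK : ((siteCluster (zdGraph d) ω 0).encard : ℝ≥0∞) ≤ (M : ℝ≥0∞) := by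
    have h1 : (siteCluster (zdGraph d) ω 0).encard ≤ (M : ℕ∞) := by
      rw [← hfin.cast_ncard_eq]
      exact_mod_cast hM
    have h2 := ENat.toENNReal_le.2 h1
    simpa using h2
  rw [bdryRatio, ← one_div]
  exact ENNReal.div_le_div hB hK

/-- **Bounded clusters: the size-sensitive threshold** (audit gen-15). On `ℤ^d`, `d ≥ 1`, an
automorphism-invariant site percolation whose cluster of the origin has almost surely at most
`M` vertices has one-site density `≤ 2dM / (2dM + 1)`: the profile bound
`E[ |∂_V^in K(0)| / |K(0)| ] ≤ 2d · P[0 ∉ ω]` [cite: LyonsPeres2016, Cor. 8.38 (proof, p. 414)]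
(`lintegral_bdryRatio_le_zd`) against `|∂_V^in K(0)| / |K(0)| ≥ 1/M` on `{0 ∈ ω}`. -/
theorem measureReal_mem_le_of_boundedClusters_zd (hd : 0 < d) {μ : Measure (SiteConfig (Site d))}
    (hμ : IsInvariantSitePercolation (zdGraph d) μ) {M : ℕ}
    (hM : ∀ᵐ ω ∂μ,
      (siteCluster (zdGraph d) ω 0).Finite ∧ (siteCluster (zdGraph d) ω 0).ncard ≤ M) :
    μ.real {ω | (0 : Site d) ∈ ω} ≤ 2 * d * M / (2 * d * M + 1) := by
  haveI : IsProbabilityMeasure μ := hμ.1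
  have hA : MeasurableSet {ω : SiteConfig (Site d) | (0 : Site d) ∈ ω} := measurableSet_mem _
  rcases Nat.eq_zero_or_pos M with rfl | hMpos
  · -- `M = 0`: the origin is almost surely closed
    have hae : ∀ᵐ ω ∂μ, ω ∉ {ω : SiteConfig (Site d) | (0 : Site d) ∈ ω} := by
      refine hM.mono fun ω hω h0 => ?_
      obtain ⟨hfin, hcard⟩ := hω
      have hempty : siteCluster (zdGraph d) ω 0 = ∅ :=
        (Set.ncard_eq_zero hfin).1 (Nat.le_zero.1 hcard)
      have h0K : (0 : Site d) ∈ siteCluster (zdGraph d) ω 0 :=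
        (mem_siteCluster_self_iff (zdGraph d) ω 0).2 h0
      rw [hempty] at h0K
      exact h0K
    have hnull : μ {ω : SiteConfig (Site d) | (0 : Site d) ∈ ω} = 0 := by
      have h := ae_iff.1 hae
      simpa only [not_not, Set.setOf_mem_eq] using h
    simp [measureReal_def, hnull]
  -- `M ≥ 1`: compare the two bounds on `E[ratio]`
  have hlow : (M : ℝ≥0∞)⁻¹ * μ {ω | (0 : Site d) ∈ ω} ≤ ∫⁻ ω, bdryRatio (zdGraph d) ω 0 ∂μ := by
    rw [← lintegral_indicator_const hA]
    refine lintegral_mono_ae (hM.mono fun ω hω => ?_)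
    by_cases h0 : (0 : Site d) ∈ ω
    · rw [Set.indicator_of_mem (show ω ∈ {ω : SiteConfig (Site d) | (0 : Site d) ∈ ω} from h0)]
      exact inv_le_bdryRatio_of_ncard_le hd h0 hω.1 hω.2
    · rw [Set.indicator_of_notMem
        (show ω ∉ {ω : SiteConfig (Site d) | (0 : Site d) ∈ ω} from h0)]
      exact zero_le
  have h := hlow.trans (lintegral_bdryRatio_le_zd d hμ)
  have hM0 : (M : ℝ≥0∞) ≠ 0 := by exact_mod_cast hMpos.ne'
  have hMtop : (M : ℝ≥0∞) ≠ ⊤ := ENNReal.natCast_ne_top M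
  rw [ENNReal.inv_mul_le_iff hM0 hMtop] at h
  -- pass to real numbers
  have hcompl : {ω : SiteConfig (Site d) | (0 : Site d) ∉ ω} = {ω | (0 : Site d) ∈ ω}ᶜ := rfl
  have hne : (M : ℝ≥0∞) * (((2 * d : ℕ) : ℝ≥0∞) * μ {ω | (0 : Site d) ∉ ω}) ≠ ⊤ :=
    ENNReal.mul_ne_top hMtop (ENNReal.mul_ne_top (ENNReal.natCast_ne_top _) (measure_ne_top _ _))
  have hreal :
      μ.real {ω | (0 : Site d) ∈ ω} ≤ M * (2 * d * (1 - μ.real {ω | (0 : Site d) ∈ ω})) := by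
    have h1 := ENNReal.toReal_mono hne h
    rw [ENNReal.toReal_mul, ENNReal.toReal_mul, ENNReal.toReal_natCast, ENNReal.toReal_natCast,
      ← measureReal_def, ← measureReal_def, hcompl, probReal_compl_eq_one_sub hA] at h1
    push_cast at h1
    exact h1
  have hpos : (0 : ℝ) < 2 * d * M + 1 := by positivity
  rw [le_div_iff₀ hpos]
  nlinarith [hreal, measureReal_nonneg (μ := μ) (s := {ω | (0 : Site d) ∈ ω})]

/-- **Bounded cluster size IS an evasion — in its size-sensitive form** (audit gen-15): for
`d ≥ 1` and every `M` there is `α_M < 1` (here `2dM/(2dM+1)`; the isoperimetric rate is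
`1 - c_d M^{-1/d}` [cite: LyonsPeres2016, Thm. 6.22]) such that every automorphism-invariant site
percolation on `ℤ^d` all of whose clusters have almost surely at most `M` vertices has one-site
density `≤ α_M` somewhere. Contrast `AmenableInvariantPercolation_bounded_threshold_zd`: no `α`
serves for all `M`. [cite: LyonsPeres2016, Cor. 8.38 (proof, p. 414)] -/
theorem AmenableInvariantPercolation_bounded_evasion_zd (hd : 0 < d) (M : ℕ) :
    ∃ α : ℝ, α < 1 ∧
      ∀ μ : Measure (SiteConfig (Site d)), IsInvariantSitePercolation (zdGraph d) μ →
        (∀ᵐ ω ∂μ, ∀ x : Site d,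
            (siteCluster (zdGraph d) ω x).Finite ∧ (siteCluster (zdGraph d) ω x).ncard ≤ M) →
          ∃ x : Site d, μ.real {ω | x ∈ ω} ≤ α := by
  refine ⟨2 * d * M / (2 * d * M + 1), ?_, fun μ hμ hM => ⟨0, ?_⟩⟩
  · have hpos : (0 : ℝ) < 2 * d * M + 1 := by positivity
    rw [div_lt_one hpos]
    linarith
  · exact measureReal_mem_le_of_boundedClusters_zd hd hμ (hM.mono fun ω h => h 0)

end Threshold

/-! ### §3. The random-phase grid has uniformly bounded clusters -/

section Grid

variable {d : ℕ} {L : ℕ} [NeZero L]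

/-- **Cells are boxes of `(L+1)^d` sites with closed inner boundary.** Every site of `ℤ^d` lies
in a box `∏_i [a_i, a_i + L]`, `a_i ≡ θ_i (mod L)`, whose inner vertex boundary consists of grid
(closed) sites of `gridConfig θ` — the proof of `gridConfig_mem_goodEvent`, keeping the box.
[cite: LyonsPeres2016, Thm. 8.37 (proof, p. 412)] -/
theorem gridConfig_exists_box (θ : GridPhase d L) (x : Site d) :
    ∃ C : Finset (Site d), x ∈ C ∧ C.card = (L + 1) ^ d ∧
      ∀ v ∈ innerBoundary (zdGraph d) C, v ∉ gridConfig θ := by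
  have hL0 : (0 : ℤ) < (L : ℤ) := by exact_mod_cast Nat.pos_of_ne_zero (NeZero.ne L)
  -- the lower walls `a i ≡ θ i`, `a i ≤ x i < a i + L`
  set a : Fin d → ℤ := fun i => x i - (x i - ((θ i).val : ℤ)) % (L : ℤ) with ha_def
  have ha_le : ∀ i, a i ≤ x i := fun i => by
    have h := Int.emod_nonneg (x i - ((θ i).val : ℤ)) hL0.ne'
    simp only [ha_def]; omega
  have hx_le : ∀ i, x i ≤ a i + L := fun i => by
    have h := Int.emod_lt_of_pos (x i - ((θ i).val : ℤ)) hL0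
    simp only [ha_def]; omega
  have ha_wall : ∀ i, ((a i : ℤ) : ZMod L) = θ i := fun i => by
    have h := Int.mul_ediv_add_emod (x i - ((θ i).val : ℤ)) (L : ℤ)
    have h' : a i = ((θ i).val : ℤ) + (L : ℤ) * ((x i - ((θ i).val : ℤ)) / (L : ℤ)) := by
      simp only [ha_def]; omega
    rw [h', Int.cast_add, Int.cast_mul, Int.cast_natCast, Int.cast_natCast, ZMod.natCast_zmod_val,
      ZMod.natCast_self, zero_mul, add_zero]
  have hb_wall : ∀ i, ((a i + (L : ℤ) : ℤ) : ZMod L) = θ i := fun i => by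
    rw [Int.cast_add, Int.cast_natCast, ZMod.natCast_self, add_zero, ha_wall]
  refine ⟨Fintype.piFinset fun i => Finset.Icc (a i) (a i + L), ?_, ?_, ?_⟩
  · rw [Fintype.mem_piFinset]
    intro i
    rw [Finset.mem_Icc]
    exact ⟨ha_le i, hx_le i⟩
  · rw [Fintype.card_piFinset]
    have hc : ∀ i, (Finset.Icc (a i) (a i + L)).card = L + 1 := fun i => by
      rw [Int.card_Icc]
      omega
    simp only [hc, Finset.prod_const, Finset.card_univ, Fintype.card_fin]
  · intro v hv hvω
    rw [mem_innerBoundary_iff] at hv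
    obtain ⟨hvC, w, hwC, hadj⟩ := hv
    rw [Fintype.mem_piFinset] at hvC
    obtain ⟨k, t, ht, rfl⟩ := (zdGraph_adj_iff_single _ _).1 hadj
    rw [Fintype.mem_piFinset] at hwC
    push Not at hwC
    obtain ⟨j, hj⟩ := hwC
    by_cases hjk : j = k
    · rw [hjk, add_single_apply_self, Finset.mem_Icc] at hj
      have hvk := hvC k
      rw [Finset.mem_Icc] at hvk
      have hcase : v k = a k ∨ v k = a k + L := by omega
      apply (mem_gridConfig.1 hvω) k
      rcases hcase with h | h
      · rw [h]; exact ha_wall k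
      · rw [h]; exact hb_wall k
    · exact hj (by rw [add_single_apply_of_ne v hjk]; exact hvC j)

/-- All clusters of the random-phase grid of period `L` have at most `(L+1)^d` vertices, for
every phase. [cite: LyonsPeres2016, Thm. 8.37 (proof, p. 412)] -/
theorem gridConfig_mem_boundedClusters (θ : GridPhase d L) :
    gridConfig θ ∈ boundedClusters (zdGraph d) ((L + 1) ^ d) := by
  intro x
  obtain ⟨C, hxC, hcard, hC⟩ := gridConfig_exists_box θ x
  have hsub : siteCluster (zdGraph d) (gridConfig θ) x ⊆ ↑C :=
    siteCluster_subset_of_innerBoundary_closed (gridConfig θ) C hC hxC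
  exact finite_and_ncard_le_iff.2 ⟨C, hcard.le, hsub⟩

end Grid

/-! ### §4. No size-blind threshold over bounded-cluster percolations -/

section Main

/-- **Bounded-cluster witnesses on `ℤ^d`** (audit gen-15): for every `d` and `α < 1` the lattice
`ℤ^d` carries a site percolation invariant under ALL graph automorphisms whose clusters are
almost surely finite with UNIFORMLY BOUNDED size, of one-site density `> α` — the random-phase
grid of period `L > d/(1-α)` (cells of `(L+1)^d` sites). The tiling witnesses in print:
[cite: DownarowiczHuczekZhang2016, Thm. 4.3] [cite: ConleyEtAl2018, Thm. 3.6]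
[cite: ElekTimar2023, Prop. 7.3 and Prop. 7.4]; the `ℤ^d` device of
[cite: LyonsPeres2016, Thm. 8.37 (proof, p. 412)]. -/
theorem AmenableInvariantPercolation_bounded_zd (d : ℕ) {α : ℝ} (hα : α < 1) :
    ∃ μ : Measure (SiteConfig (Site d)), IsInvariantSitePercolation (zdGraph d) μ ∧
      (∃ M : ℕ, ∀ᵐ ω ∂μ, ∀ x : Site d,
          (siteCluster (zdGraph d) ω x).Finite ∧ (siteCluster (zdGraph d) ω x).ncard ≤ M) ∧
      ∀ x : Site d, α < μ.real {ω | x ∈ ω} := by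
  -- a period `L ≥ 1` with `d / L < 1 - α`
  obtain ⟨L₀, hL₀⟩ := exists_nat_gt ((d : ℝ) / (1 - α))
  obtain ⟨L, hL1, hLL₀⟩ : ∃ L : ℕ, 1 ≤ L ∧ L₀ ≤ L := ⟨max L₀ 1, le_max_right _ _, le_max_left _ _⟩
  haveI : NeZero L := ⟨by omega⟩
  have hLd : (d : ℝ) / L < 1 - α := by
    have h1 : (0 : ℝ) < 1 - α := by linarith
    have hLpos : (0 : ℝ) < L := by exact_mod_cast (show 0 < L by omega)
    have h2 : (d : ℝ) / (1 - α) < L := lt_of_lt_of_le hL₀ (by exact_mod_cast hLL₀)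
    rw [div_lt_iff₀ h1] at h2
    rw [div_lt_iff₀ hLpos]
    linarith
  refine ⟨gridPerc d L, isInvariantSitePercolation_gridPerc, ⟨(L + 1) ^ d, ?_⟩, fun x => ?_⟩
  · exact ae_gridPerc_of_forall (P := fun ω => ω ∈ boundedClusters (zdGraph d) ((L + 1) ^ d))
      (measurableSet_boundedClusters _) gridConfig_mem_boundedClusters
  · have h := gridPerc_real_mem_ge (d := d) (L := L) x
    linarith

/-- **No size-blind threshold over bounded-cluster invariant percolations on `ℤ^d`** (audit
gen-15): there is no `α < 1` such that every automorphism-invariant site percolation on `ℤ^d`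
whose clusters are almost surely finite of uniformly bounded size has one-site density `≤ α`
somewhere. Restricting the universal finite-cluster threshold of
[cite: LyonsPeres2016, Thm. 8.16 and Cor. 8.17] to percolations with bounded (tile-like) clusters
— the witnesses of [cite: DownarowiczHuczekZhang2016, Thm. 4.3] [cite: ConleyEtAl2018, Thm. 3.6]
[cite: ElekTimar2023, Thm. 4] — does not evade the barrier `AmenableInvariantPercolation`
[cite: LyonsPeres2016, Thm. 8.37]; for each FIXED bound it does
(`AmenableInvariantPercolation_bounded_evasion_zd`). -/
theorem AmenableInvariantPercolation_bounded_threshold_zd (d : ℕ) :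
    ¬ ∃ α : ℝ, α < 1 ∧
        ∀ μ : Measure (SiteConfig (Site d)), IsInvariantSitePercolation (zdGraph d) μ →
          (∃ M : ℕ, ∀ᵐ ω ∂μ, ∀ x : Site d,
              (siteCluster (zdGraph d) ω x).Finite ∧ (siteCluster (zdGraph d) ω x).ncard ≤ M) →
            ∃ x : Site d, μ.real {ω | x ∈ ω} ≤ α := by
  rintro ⟨α, hα, hthr⟩
  obtain ⟨μ, hμ, hbd, hdens⟩ := AmenableInvariantPercolation_bounded_zd d hα
  obtain ⟨x, hx⟩ := hthr μ hμ hbd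
  exact absurd (hdens x) (not_lt.2 hx)

/-- The cubic lattice `ℤ³`: bounded-cluster invariant site percolations of every density `< 1`
exist, so no size-blind threshold over them; for each bound `M` the density is `≤ 6M/(6M+1)`.
[cite: LyonsPeres2016, Thm. 8.37 and Cor. 8.38] -/
theorem AmenableInvariantPercolation_bounded_threshold_z3 :
    (¬ ∃ α : ℝ, α < 1 ∧
        ∀ μ : Measure (SiteConfig (Site 3)), IsInvariantSitePercolation (zdGraph 3) μ →
          (∃ M : ℕ, ∀ᵐ ω ∂μ, ∀ x : Site 3,
              (siteCluster (zdGraph 3) ω x).Finite ∧ (siteCluster (zdGraph 3) ω x).ncard ≤ M) →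
            ∃ x : Site 3, μ.real {ω | x ∈ ω} ≤ α) ∧
    ∀ M : ℕ, ∀ μ : Measure (SiteConfig (Site 3)), IsInvariantSitePercolation (zdGraph 3) μ →
      (∀ᵐ ω ∂μ, ∀ x : Site 3,
          (siteCluster (zdGraph 3) ω x).Finite ∧ (siteCluster (zdGraph 3) ω x).ncard ≤ M) →
        μ.real {ω | (0 : Site 3) ∈ ω} ≤ 6 * M / (6 * M + 1) := by
  refine ⟨AmenableInvariantPercolation_bounded_threshold_zd 3, fun M μ hμ hM => ?_⟩
  have h := measureReal_mem_le_of_boundedClusters_zd (d := 3) (by norm_num) hμ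
    (hM.mono fun ω h => h 0)
  norm_num at h
  exact h

end Main

end Literature.Barriers.CriticalPhenomena

end
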